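/-
Copyright (c) 2026 the pub-hodgecm-mathlib formalisation cell (harness21).  Prover seat hodgecm-mathlib-R90-C131-p05 (g0), HCML SLAB R90-TF,
section S4 «Ch. 13.1–2» (dealer K2E2-plan (g6)), ROAD «KEYS2-ANALYTIC» (MEMO `R90/R90-C131-p05/g0/MEMO-KEYS2-analytic-road.v1.md`), brick (ε1)
«U(Φ₂) BIG CELL», FILE B (far out).  2026-09-04/05.
-/
import Summits.HodgeConjecture.HodgeConjecture.Theorems.R90S4Keys2BigCell                  -- ★ FILE A (this seat): `toFun_weylElt_mul_eq_of_isUnit_two`; brings the N = 2 kit and the line chart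
import Summits.HodgeConjecture.HodgeConjecture.Theorems.F0P3cStCharTSCellFunFarOut         -- ★ B4 (N = 3): `exists_unitModulusChar_le_imp_le_valued` (rank-free statement)
import HarnessLib

/-!
# R90-TF · S4 — ROAD «KEYS2-ANALYTIC», brick (ε1) FILE B «CELL FUNCTION FAR OUT ON `U(Φ₂)(L⁺_v)`»: at a non-split `v`, for every smooth vector `f ∈ i((χ₁, χ₂))`
# there is `A₀` with `f(w₀ n(b)) = (χ₁(σ b)⁻¹ · χ₂(−1) · ‖b‖^{-1/2}) · f(1)` whenever `‖b‖ ≥ A₀`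

Cell `hodgecm-mathlib`, crux H413 (`stmt-HodgeConjecture-24833`, lane `--supports … --as helper`), route of record `HCCMUnconditional` (no route verbs;
count-neutral).  Programme R90-TF, section S4 (Rogawski Ch. 13.1–2, base `R90-C131`); seat R90-C131-p05 (g0).  THEOREMS ONLY (no `def`, no instance,
no notation, no named fact, no `sorry`); imports ★ only.  The `N = 2` twin of ★ `F0P3cStCharTSCellFunFarOut` §3–§4.

THE MATHEMATICS ([Rogawski1990, §1.10, §11.1, §12.1]; [Casselman1995, Prop. 1.3.3, §6.4]).  By ★ FILE A, `f(w₀ n(b)) = χ₁(σ b)⁻¹ · χ₂(−1) · ‖b‖^{-1/2} ·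
f(w₀ n(b⁻¹) w₀⁻¹)`.  The stabiliser of the smooth vector `f` is an open neighbourhood `V` of `1` (★ `Representation.isSmooth_smoothInd`); through the line chart
`e : R⁻ ≃ₜ N₂` (★ `LineRing.exists_lineChart`) the map `y ↦ w₀ e(y) w₀⁻¹` is continuous with value `1` at `y = 0`, so `w₀ n(b⁻¹) w₀⁻¹ ∈ V` as soon as `|b⁻¹|_w` is
small (`v` non-split: ONE place `w ∣ v`, valuation balls from `Valued.mem_nhds_zero`), i.e. `|b|_w` large, which `‖b‖ ≥ A₀` forces (★ `exists_unitModulusChar_le_imp_le_valued`).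
* `exists_unipotent_entry_eq_inv_two` (`n(b⁻¹) ∈ N₂`), `weylConj_mem_of_le_valued_two`, **`exists_toFun_weylElt_mul_eq_mul_toFun_one_two`** (the head).
HONEST LABEL: HC_CM is proved only modulo the 7 printed citations (2 remaining named inputs: hLiu418 = stmt-HodgeConjecture-24832,
h413 = stmt-HodgeConjecture-24833) until rung 0 closes; organ-level computation, closes nothing by itself; count-neutral.

## References
* [Rogawski1990] J. D. Rogawski, *Automorphic Representations of Unitary Groups in Three Variables*, Ann. of Math. Stud. 123 (1990), §1.10 p. 9, §11.1 p. 161,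
  §12.1 p. 171.
* [Casselman1995] W. Casselman, *Introduction to the theory of admissible representations of 𝔭-adic reductive groups* (1995), Prop. 1.3.3, §6.4.
* [Keys1984] D. Keys, *Principal series representations of special unitary groups over local fields*, Compositio Math. 51 (1984), §3, §7.
-/

set_option autoImplicit false
-- the mandated namespace (brief §3.4) repeats the single-problem summit's segment (`HodgeConjecture.HodgeConjecture`)
set_option linter.dupNamespace false

noncomputable section

open NumberField IsDedekindDomain MeasureTheory Topology Filter
open scoped Matrix MatrixGroups NNReal
open Literature.NumberTheory.Automorphic Literature.NumberTheory.Automorphic.UnitaryGroup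
open Summit.HodgeConjecture.HodgeConjecture.Cruxes.H413.F0P3cStCharTSBigCellFactorisation (neg_one_mem_normOneUnits)

namespace Summit.HodgeConjecture.HodgeConjecture.R90.S4

/-! ## `v` NON-SPLIT: far out on the big cell the lower factor `w₀ u′ w₀⁻¹` tends to `1`; the cell function far out -/

section Nonsplit

variable (L : Type) [Field L] [NumberField L] [IsCMField L] (v : HeightOneSpectrum (𝓞 ↥(maximalRealSubfield L)))
  (w : PlacesOver L v) (hw : IsCMField.complexConj L • w.1 = w.1)
  (w₀ : ↥(unitaryGroupOfForm (conjLocal L (IsCMField.complexConj L) v) (cmLocalForm L 2 v)))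
  (hw₀ : Units.val (w₀ : GL (Fin 2) (LocalRing L v)) = cmLocalForm L 2 v)

/-- **`N₂` has an element with any prescribed skew entry**: for `u ∈ N₂` with `u₀₁ = b` a unit there is `u′ ∈ N₂` with `u′₀₁ = b⁻¹` (`b⁻¹` is skew:
`σ(b⁻¹) = σ(b)⁻¹ = (−b)⁻¹`; the line chart ★ `LineRing.exists_lineChart`). [cite: Rogawski1990, §1.10 p. 9] -/
theorem exists_unipotent_entry_eq_inv_two (u : ↥(cmBorelTriple L 2 v).N) (b : (LocalRing L v)ˣ)
    (hbu : (((u : ↥(unitaryGroupOfForm (conjLocal L (IsCMField.complexConj L) v) (cmLocalForm L 2 v))) : GL (Fin 2) (LocalRing L v)) :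
      Matrix (Fin 2) (Fin 2) (LocalRing L v)) 0 1 = b) :
    ∃ u' : ↥(cmBorelTriple L 2 v).N,
      (((u' : ↥(unitaryGroupOfForm (conjLocal L (IsCMField.complexConj L) v) (cmLocalForm L 2 v))) : GL (Fin 2) (LocalRing L v)) :
        Matrix (Fin 2) (Fin 2) (LocalRing L v)) 0 1 = ↑b⁻¹ := by
  have hJ := cmLocalForm_eq_over L 2 v
  have hσb : conjLocal L (IsCMField.complexConj L) v (b : LocalRing L v) = -(b : LocalRing L v) := by
    rw [← hbu]; exact LineRing.map_umat_zero_one_two (conjLocal L (IsCMField.complexConj L) v) hJ u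
  have hbbi : (b : LocalRing L v) * ↑b⁻¹ = 1 := b.mul_inv
  have hσbi : conjLocal L (IsCMField.complexConj L) v (↑b⁻¹ : LocalRing L v) = -(↑b⁻¹ : LocalRing L v) := by
    have h : conjLocal L (IsCMField.complexConj L) v (b : LocalRing L v) * conjLocal L (IsCMField.complexConj L) v (↑b⁻¹ : LocalRing L v) = 1 := by
      rw [← map_mul, hbbi, map_one]
    rw [hσb] at h
    linear_combination (-(↑b⁻¹ : LocalRing L v)) * h - (conjLocal L (IsCMField.complexConj L) v (↑b⁻¹ : LocalRing L v)) * hbbi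
  have hy : (↑b⁻¹ : LocalRing L v) ∈ HeisRing.skewPart (conjLocal L (IsCMField.complexConj L) v) := (HeisRing.mem_skewPart_iff _ _).2 hσbi
  obtain ⟨e, he, -⟩ := LineRing.exists_lineChart (conjLocal L (IsCMField.complexConj L) v) hJ
  exact ⟨e ⟨_, hy⟩, he _⟩

include hw in
set_option maxHeartbeats 1600000 in
/-- **FAR OUT, THE LOWER FACTOR IS NEAR `1`**: for every neighbourhood `V` of `1` in `G = U(Φ₂)(L⁺_v)` (`v` non-split, `w ∣ v`) there is a valuation bound `γ₀ ≠ 0` such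
that for every `u ∈ N₂` with `γ₀ ≤ |u₀₁|_w` and every `u′ ∈ N₂` with `u′₀₁ · u₀₁ = 1`, `w₀ u′ w₀⁻¹ ∈ V`: `u′ = e(y′)` in the line chart ★ `LineRing.exists_lineChart` with
`|y′|_w = |u₀₁|_w⁻¹ → 0`, and `y ↦ w₀ e(y) w₀⁻¹` is continuous with value `1` at `0`; valuation balls from Mathlib's `Valued.mem_nhds_zero` at the one place above `v`.
[cite: Casselman1995, §6.4] [cite: Rogawski1990, §1.10 p. 9] -/
theorem weylConj_mem_of_le_valued_two (V : Set ↥(unitaryGroupOfForm (conjLocal L (IsCMField.complexConj L) v) (cmLocalForm L 2 v)))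
    (hV : V ∈ 𝓝 (1 : ↥(unitaryGroupOfForm (conjLocal L (IsCMField.complexConj L) v) (cmLocalForm L 2 v)))) :
    ∃ γ₀ : WithZero (Multiplicative ℤ), γ₀ ≠ 0 ∧
      ∀ u u' : ↥(cmBorelTriple L 2 v).N,
        γ₀ ≤ Valued.v ((((u : ↥(unitaryGroupOfForm (conjLocal L (IsCMField.complexConj L) v) (cmLocalForm L 2 v))) : GL (Fin 2) (LocalRing L v)) :
          Matrix (Fin 2) (Fin 2) (LocalRing L v)) 0 1 w) →
        (((u' : ↥(unitaryGroupOfForm (conjLocal L (IsCMField.complexConj L) v) (cmLocalForm L 2 v))) : GL (Fin 2) (LocalRing L v)) :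
            Matrix (Fin 2) (Fin 2) (LocalRing L v)) 0 1 *
          (((u : ↥(unitaryGroupOfForm (conjLocal L (IsCMField.complexConj L) v) (cmLocalForm L 2 v))) : GL (Fin 2) (LocalRing L v)) :
            Matrix (Fin 2) (Fin 2) (LocalRing L v)) 0 1 = 1 →
        w₀ * (u' : ↥(unitaryGroupOfForm (conjLocal L (IsCMField.complexConj L) v) (cmLocalForm L 2 v))) * w₀⁻¹ ∈ V := by
  classical
  haveI : Subsingleton (PlacesOver L v) :=
    PlacesOver.subsingleton_of_smul_eq (IsCMField.complexConj L) (IsCMField.complexConj_ne_one L) w hw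
  have hJ := cmLocalForm_eq_over L 2 v
  -- the chart `R⁻ ≃ₜ N₂` and the conjugation map
  obtain ⟨e, he, hadd⟩ := LineRing.exists_lineChart (conjLocal L (IsCMField.complexConj L) v) hJ
  have h0 : e 0 = 1 := by
    have h := hadd 0 0
    rw [add_zero] at h
    have h' : e 0 * e 0 = e 0 * 1 := by rw [mul_one]; exact h.symm
    exact mul_left_cancel h'
  have hcont : Continuous fun y : ↥(HeisRing.skewPart (conjLocal L (IsCMField.complexConj L) v)) =>
      w₀ * ((e y : ↥(cmBorelTriple L 2 v).N) : ↥(unitaryGroupOfForm (conjLocal L (IsCMField.complexConj L) v) (cmLocalForm L 2 v))) * w₀⁻¹ :=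
    (continuous_const.mul (continuous_subtype_val.comp e.continuous)).mul continuous_const
  have hpt : w₀ * ((e 0 : ↥(cmBorelTriple L 2 v).N) : ↥(unitaryGroupOfForm (conjLocal L (IsCMField.complexConj L) v) (cmLocalForm L 2 v))) * w₀⁻¹ = 1 := by
    rw [h0, OneMemClass.coe_one, mul_one, mul_inv_cancel]
  have hS : (fun y : ↥(HeisRing.skewPart (conjLocal L (IsCMField.complexConj L) v)) =>
      w₀ * ((e y : ↥(cmBorelTriple L 2 v).N) : ↥(unitaryGroupOfForm (conjLocal L (IsCMField.complexConj L) v) (cmLocalForm L 2 v))) * w₀⁻¹) ⁻¹' V ∈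
        𝓝 (0 : ↥(HeisRing.skewPart (conjLocal L (IsCMField.complexConj L) v))) :=
    hcont.continuousAt.preimage_mem_nhds (by rw [hpt]; exact hV)
  -- a valuation ball inside the preimage (one place above `v`)
  obtain ⟨γ, hγ0, hγ⟩ : ∃ γ : WithZero (Multiplicative ℤ), γ ≠ 0 ∧ ∀ y : ↥(HeisRing.skewPart (conjLocal L (IsCMField.complexConj L) v)),
      Valued.v ((y : LocalRing L v) w) < γ →
        w₀ * ((e y : ↥(cmBorelTriple L 2 v).N) : ↥(unitaryGroupOfForm (conjLocal L (IsCMField.complexConj L) v) (cmLocalForm L 2 v))) * w₀⁻¹ ∈ V := by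
    obtain ⟨V₂', hV₂', hsub'⟩ := (mem_nhds_subtype _ _ _).1 hS
    rw [ZeroMemClass.coe_zero, nhds_pi, Filter.mem_pi] at hV₂'
    obtain ⟨I, -, t, ht, hsub⟩ := hV₂'
    obtain ⟨g, hg⟩ := Valued.mem_nhds_zero.1 (ht w)
    refine ⟨MonoidWithZeroHom.ValueGroup₀.embedding g.1, MonoidWithZeroHom.ValueGroup₀.embedding_unit_ne_zero g,
      fun y hy => hsub' (hsub fun i _ => ?_)⟩
    obtain rfl : i = w := Subsingleton.elim i w
    exact hg ((Valuation.restrict_lt_iff_lt_embedding _).2 hy)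
  -- the threshold
  set N : ℤ := |WithZero.log γ| + 1 with hN
  refine ⟨WithZero.exp N, WithZero.exp_ne_zero, fun u u' hB hz => ?_⟩
  set b : LocalRing L v := (((u : ↥(unitaryGroupOfForm (conjLocal L (IsCMField.complexConj L) v) (cmLocalForm L 2 v))) : GL (Fin 2) (LocalRing L v)) :
        Matrix (Fin 2) (Fin 2) (LocalRing L v)) 0 1 with hb
  set z' : LocalRing L v := (((u' : ↥(unitaryGroupOfForm (conjLocal L (IsCMField.complexConj L) v) (cmLocalForm L 2 v))) : GL (Fin 2) (LocalRing L v)) :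
        Matrix (Fin 2) (Fin 2) (LocalRing L v)) 0 1 with hz'
  have hB0 : Valued.v (b w) ≠ 0 := (lt_of_lt_of_le WithZero.exp_pos hB).ne'
  have hlogB : N ≤ WithZero.log (Valued.v (b w)) := (WithZero.le_log_iff_exp_le hB0).2 hB
  have hzw : Valued.v (z' w) * Valued.v (b w) = 1 := by
    rw [← map_mul, ← Pi.mul_apply, hz, Pi.one_apply, map_one]
  have hn1 := le_abs_self (WithZero.log γ)
  have hn2 := neg_abs_le (WithZero.log γ)
  have hz_lt : Valued.v (z' w) < γ := by
    have hz0 : Valued.v (z' w) ≠ 0 := fun h0' => by rw [h0', zero_mul] at hzw; exact zero_ne_one hzw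
    have e1 : WithZero.log (Valued.v (z' w)) + WithZero.log (Valued.v (b w)) = 0 := by
      rw [← WithZero.log_mul hz0 hB0, hzw, WithZero.log_one]
    exact (WithZero.log_lt_log hz0 hγ0).1 (by omega)
  -- `u′ = e(z′)` through the chart
  have hy : z' ∈ HeisRing.skewPart (conjLocal L (IsCMField.complexConj L) v) :=
    LineRing.umat_zero_one_mem_skewPart (conjLocal L (IsCMField.complexConj L) v) hJ u'
  have hu' : e ⟨z', hy⟩ = u' := LineRing.ext_two (conjLocal L (IsCMField.complexConj L) v) (he ⟨z', hy⟩)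
  have hmem := hγ ⟨z', hy⟩ hz_lt
  rw [hu'] at hmem
  exact hmem

variable (hns : ∀ w : PlacesOver L v, IsCMField.complexConj L • w.1 = w.1)
  (χ₁ : (LocalRing L v)ˣ →* ℂˣ) (χ₂ : ↥(normOneUnits (conjLocal L (IsCMField.complexConj L) v)) →* ℂˣ)

set_option synthInstance.maxHeartbeats 400000 in
set_option maxHeartbeats 1600000 in
-- statement over the `SmoothInd` carrier of ★ `cmPrincipalSeries` (class of §2)
include hns hw₀ in
/-- **«CELL FUNCTION FAR OUT» ON `U(Φ₂)(L⁺_v)`** (twin of ★ B4 of the road «KEYS3-ANALYTIC»): `v` NON-SPLIT, `w₀` the element of matrix `Φ₂`, `f` ANY vector of the carrier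
of ★ `cmPrincipalSeries L 2 v ((χ₁, χ₂))`.  There is `A₀ : ℝ≥0` such that for every `u ∈ N₂` whose entry `b = u₀₁` is a unit of modulus `‖b‖ ≥ A₀`:
  `f(w₀ u) = (χ₁(σ b)⁻¹ · χ₂(−1) · ‖b‖^{-1/2}) · f(1)`
(§2 + the stabiliser of the smooth vector `f` is open ★ `Representation.isSmooth_smoothInd`, so `f(w₀ u′ w₀⁻¹) = f(1)` once `|b|_w` is large — `weylConj_mem_of_le_valued_two` — and
`‖b‖ ≥ A₀` forces that, ★ `exists_unitModulusChar_le_imp_le_valued`).  For the standard section (`f₀(1) = 1`) this is the tail `F(n(b)) = χ₁(σ b)⁻¹ χ₂(−1) ‖b‖^{-1/2}` of the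
intertwining integrand of the l.d.s. point `χ₁|F^× = ω`. [cite: Rogawski1990, §11.1 p. 161; §12.1 p. 171] [cite: Casselman1995, §6.4] [cite: Keys1984, §3, §7] -/
theorem exists_toFun_weylElt_mul_eq_mul_toFun_one_two
    (f : haveI := locallyCompactSpace_cmBorelU L 2 v
      Representation.SmoothInd (cmBorelTriple L 2 v).P
        (Representation.twist
          (((Representation.trivial ℂ ↥(torusU (conjLocal L (IsCMField.complexConj L) v) (cmLocalForm L 2 v)) ℂ).twist
            (torusCharPair (conjLocal L (IsCMField.complexConj L) v) (cmLocalForm L 2 v) (cmLocalForm_eq_over L 2 v) 0 χ₁ χ₂)).comp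
            (cmBorelTriple L 2 v).proj) (rootDeltaChar (cmBorelTriple L 2 v).P))) :
    ∃ A₀ : ℝ≥0, ∀ (u : ↥(cmBorelTriple L 2 v).N)
      (hb : IsUnit ((((u : ↥(unitaryGroupOfForm (conjLocal L (IsCMField.complexConj L) v) (cmLocalForm L 2 v))) : GL (Fin 2) (LocalRing L v)) :
        Matrix (Fin 2) (Fin 2) (LocalRing L v)) 0 1)),
      A₀ ≤ unitModulusChar (LocalRing L v) hb.unit →
        f.toFun (w₀ * (u : ↥(unitaryGroupOfForm (conjLocal L (IsCMField.complexConj L) v) (cmLocalForm L 2 v)))) =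
          ((((χ₁ (Units.map (conjLocal L (IsCMField.complexConj L) v : LocalRing L v →* LocalRing L v) hb.unit))⁻¹ : ℂˣ) : ℂ) *
              ((χ₂ ⟨-1, neg_one_mem_normOneUnits (conjLocal L (IsCMField.complexConj L) v)⟩ : ℂˣ) : ℂ) *
              (((halfModulusChar (LocalRing L v) hb.unit)⁻¹ : ℂˣ) : ℂ)) * f.toFun 1 := by
  haveI := locallyCompactSpace_cmBorelU L 2 v
  obtain ⟨w⟩ : Nonempty (PlacesOver L v) := inferInstance
  have hw := hns w
  -- the stabiliser of the smooth vector `f` is an open neighbourhood of `1`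
  have hopen : IsOpen (((Representation.smoothIndRep (cmBorelTriple L 2 v).P _).stabilizerSubgroup f :
      Subgroup ↥(unitaryGroupOfForm (conjLocal L (IsCMField.complexConj L) v) (cmLocalForm L 2 v))) :
        Set ↥(unitaryGroupOfForm (conjLocal L (IsCMField.complexConj L) v) (cmLocalForm L 2 v))) :=
    Representation.isSmooth_smoothInd _ _ f
  have hV := hopen.mem_nhds (Subgroup.one_mem _)
  obtain ⟨γ₀, -, hγ₀⟩ := weylConj_mem_of_le_valued_two L v w hw w₀ _ hV
  obtain ⟨A₀, hA₀⟩ := Cruxes.H413.F0P3cStCharTSCellFunFarOut.exists_unitModulusChar_le_imp_le_valued L v w hw γ₀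
  refine ⟨A₀, fun u hb hle => ?_⟩
  obtain ⟨u', h1⟩ := exists_unipotent_entry_eq_inv_two L v u hb.unit hb.unit_spec.symm
  have hexact := toFun_weylElt_mul_eq_of_isUnit_two L v χ₁ χ₂ w₀ hw₀ f u u' hb.unit hb.unit_spec.symm h1
  -- far out: the lower factor stabilises `f`
  have hval : γ₀ ≤ Valued.v ((((u : ↥(unitaryGroupOfForm (conjLocal L (IsCMField.complexConj L) v) (cmLocalForm L 2 v))) : GL (Fin 2) (LocalRing L v)) :
      Matrix (Fin 2) (Fin 2) (LocalRing L v)) 0 1 w) := by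
    have := hA₀ hb.unit hle
    rwa [hb.unit_spec] at this
  have hz : (((u' : ↥(unitaryGroupOfForm (conjLocal L (IsCMField.complexConj L) v) (cmLocalForm L 2 v))) : GL (Fin 2) (LocalRing L v)) :
        Matrix (Fin 2) (Fin 2) (LocalRing L v)) 0 1 *
      (((u : ↥(unitaryGroupOfForm (conjLocal L (IsCMField.complexConj L) v) (cmLocalForm L 2 v))) : GL (Fin 2) (LocalRing L v)) :
        Matrix (Fin 2) (Fin 2) (LocalRing L v)) 0 1 = 1 := by
    rw [h1, hb.val_inv_mul]
  have hmem := hγ₀ u u' hval hz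
  have hfix : f.toFun (w₀ * (u' : ↥(unitaryGroupOfForm (conjLocal L (IsCMField.complexConj L) v) (cmLocalForm L 2 v))) * w₀⁻¹) = f.toFun 1 := by
    have h := Representation.mem_stabilizerSubgroup _ _ _ |>.1 hmem
    have h' := congrArg (fun φ => Representation.SmoothInd.toFun φ 1) h
    simp only [Representation.toFun_smoothIndRep_apply, one_mul] at h'
    exact h'
  rw [hexact, hfix]

end Nonsplit

end Summit.HodgeConjecture.HodgeConjecture.R90.S4

end
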